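import Literature.NumberTheory.ComplexMultiplication.PartialConjugationOfConjSquare
import HarnessLib

/-!
# Partial conjugations from a SQUARE ROOT of complex conjugation in `Aut(ℂ)` and a degree not divisible by `4`

Companion of `NumberTheory/ComplexMultiplication/PartialConjugationOfRealIntersection` (two slots: partial
conjugations exist iff complex conjugation fixes `L_{i₀} ∩ L_{i₁}` pointwise, `L_i = normalClosure ℚ K_i ℂ`) and of
`…/PartialConjugationOfConjSquare` (square `conjGal` + `[L_{i₀} ∩ L_{i₁} : ℚ] ≤ 2`).  Here the intersection need not be
computed at all: a DEGREE condition on one side and a SQUARE ROOT OF CONJUGATION on the other suffice.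

* **`conj_apply_eq_of_apply_apply_eq_conj_of_not_dvd`** — if `M ≤ ℂ` is finite and normal over `ℚ`, some `τ ∈ Aut(ℂ)`
  satisfies `τ(τ x) = x̄` on `M`, and `4 ∤ [M : ℚ]`, then complex conjugation fixes `M` pointwise.  Proof: `τ` restricts to
  `t ∈ Gal(M/ℚ)` with `t² = c` (conjugation on `M`); if `c ≠ 1` then `t` has order `4`, which divides
  `|Gal(M/ℚ)| = [M : ℚ]` — contradiction.
* **`forall_exists_partialConj_pair_of_smul_smul_of_not_dvd`** — two slots `i₀ ≠ i₁`; if (□) some `τ ∈ Aut(ℂ)` has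
  `τ ∘ τ ∘ s = s̄` for every `s : K_{i₁} → ℂ` (conjugation on `Hom(K_{i₁}, ℂ)` has a square root in the image of `Aut(ℂ)`:
  Galois CM fields with `conjGal` a square — cyclic of degree `≡ 0 (mod 4)`, `ℚ(ζ_p)` for `p ≡ 1 (mod 4)`, the dihedral and
  quaternion octics —, and NON-Galois quartic CM fields, `Summits/…/QuarticCMConjugationSquare`) and `4 ∤ [L_{i₀} : ℚ]`
  (e.g. `K_{i₀}` imaginary quadratic, or Galois CM of degree `≡ 2 (mod 4)`: cyclic sextics, `ℚ(ζ_p)` for `p ≡ 3 (mod 4)`,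
  `ℚ(ζ_9)`, …), then both slots carry partial conjugations: `τ²` is conjugation on `L_{i₁}` hence on
  `M = L_{i₀} ∩ L_{i₁}`, and `[M : ℚ] ∣ [L_{i₀} : ℚ]`.
* `apply_apply_eq_conj_of_forall_smul_smul` — (□) on the embeddings gives `τ(τ x) = x̄` on the whole Galois closure.

Everything is proved; theorems only, no definition, no named fact, no `sorry`.

## References

* [Lang2002] S. Lang, *Algebra*, 3rd ed., GTM 211, VI §1 Thm. 1.1, Cor. 1.4 (`|Gal(M/ℚ)| = [M : ℚ]`; orders of elements).
* [Shimura1998] G. Shimura, *Abelian Varieties with Complex Multiplication and Modular Functions*, §8.4 Example (2).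
* [Gordon1999HodgeAVSurvey] B. B. Gordon, *A survey of the Hodge conjecture for abelian varieties*, §3 Theorem (proof).
-/

noncomputable section

open IntermediateField Module NumberField

namespace Literature.NumberTheory.ComplexMultiplication

/-! ### A square root of conjugation on a normal field of degree not divisible by `4` -/

section Sqrt

/-- An automorphism of `ℂ` fixes `ℚ`. [folklore] -/
private theorem ringEquiv_apply_algebraMap' (g : ℂ ≃+* ℂ) (q : ℚ) : g (algebraMap ℚ ℂ q) = algebraMap ℚ ℂ q := by
  rw [eq_ratCast]
  exact map_ratCast g q

/-- **A square root of conjugation forces a totally real field in degree `≢ 0 (mod 4)`.**  Let `M ≤ ℂ` be finite and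
normal over `ℚ` (instance for `IntermediateField.algebra'`), `τ ∈ Aut(ℂ)` with `τ (τ x) = x̄` for all `x ∈ M`, and
`4 ∤ [M : ℚ]`.  Then complex conjugation fixes `M` pointwise: otherwise `τ|_M ∈ Gal(M/ℚ)` has order `4 ∣ [M : ℚ]`.
[cite: Lang2002, VI §1 Thm. 1.1 and Cor. 1.4] -/
theorem conj_apply_eq_of_apply_apply_eq_conj_of_not_dvd (M : IntermediateField ℚ ℂ) [FiniteDimensional ℚ M]
    [@Normal ℚ M _ _ (IntermediateField.algebra' M)] (τ : ℂ ≃+* ℂ)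
    (hτ : ∀ x : ℂ, x ∈ M → τ (τ x) = starRingEnd ℂ x) (h4 : ¬ 4 ∣ finrank ℚ M) {x : ℂ} (hx : x ∈ M) :
    starRingEnd ℂ x = x := by
  letI iM : Algebra ℚ ↥M := IntermediateField.algebra' M
  haveI : Algebra.IsSeparable ℚ (↥M) := Algebra.IsAlgebraic.isSeparable_of_perfectField
  haveI : IsGalois ℚ (↥M) := ⟨⟩
  let τQ : ℂ ≃ₐ[ℚ] ℂ := AlgEquiv.ofRingEquiv (f := τ) (ringEquiv_apply_algebraMap' τ)
  let t : (↥M) ≃ₐ[ℚ] ↥M := τQ.restrictNormal ↥M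
  have ht : ∀ y : ↥M, ((t y : ↥M) : ℂ) = τ y := fun y => AlgEquiv.restrictNormal_commutes τQ (↥M) y
  let cQ : ℂ ≃ₐ[ℚ] ℂ := AlgEquiv.ofRingEquiv (f := (starRingAut : ℂ ≃+* ℂ)) (ringEquiv_apply_algebraMap' _)
  let c : (↥M) ≃ₐ[ℚ] ↥M := cQ.restrictNormal ↥M
  have hc : ∀ y : ↥M, ((c y : ↥M) : ℂ) = starRingEnd ℂ y := fun y => AlgEquiv.restrictNormal_commutes cQ (↥M) y
  have ht2 : t ^ 2 = c := by
    rw [pow_two]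
    refine AlgEquiv.ext fun y => Subtype.ext ?_
    rw [AlgEquiv.mul_apply, ht, ht, hc]
    exact hτ y y.2
  have hc2 : c ^ 2 = 1 := by
    rw [pow_two]
    refine AlgEquiv.ext fun y => Subtype.ext ?_
    rw [AlgEquiv.mul_apply, AlgEquiv.one_apply, hc, hc]
    exact Complex.conj_conj _
  by_contra hne
  have hc1 : c ≠ 1 := by
    intro h1
    have h2 := hc ⟨x, hx⟩
    rw [h1, AlgEquiv.one_apply] at h2
    exact hne h2.symm
  have ht4 : t ^ 2 ^ (1 + 1) = 1 := by
    rw [show 2 ^ (1 + 1) = 2 * 2 from rfl, pow_mul, ht2, hc2]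
  have ht2' : ¬ t ^ 2 ^ 1 = 1 := by rwa [pow_one, ht2]
  have hord : orderOf t = 2 ^ (1 + 1) := orderOf_eq_prime_pow ht2' ht4
  apply h4
  rw [← IsGalois.card_aut_eq_finrank, show (4 : ℕ) = 2 ^ (1 + 1) from rfl, ← hord]
  exact orderOf_dvd_natCard t

end Sqrt

/-! ### Two slots: (□) on one side, `4 ∤` degree on the other -/

section Pair

variable {I : Type} {K : I → Type} [∀ i, Field (K i)] [∀ i, NumberField (K i)]

/-- (□) on the embeddings of `K_i` — `τ ∘ τ ∘ s = s̄` for every `s : K_i → ℂ` — gives `τ (τ x) = x̄` on the whole Galois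
closure `L_i` of `K_i` in `ℂ` (the compositum of the `s(K_i)`). [cite: Lang2002, V §3 Thm. 3.3] -/
theorem apply_apply_eq_conj_of_forall_smul_smul (i : I) {τ : ℂ ≃+* ℂ}
    (hτ : ∀ s : K i →+* ℂ, τ • τ • s = (starRingAut : ℂ ≃+* ℂ) • s) {x : ℂ} (hx : x ∈ normalClosure ℚ (K i) ℂ) :
    τ (τ x) = starRingEnd ℂ x := by
  have h : τ (τ x) = (starRingAut : ℂ ≃+* ℂ) x :=
    apply_eq_of_forall_smul_eq i (σ := τ * τ) (σ' := (starRingAut : ℂ ≃+* ℂ)) (fun s => by rw [mul_smul]; exact hτ s) hx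
  rw [starRingAut_apply, ← starRingEnd_apply] at h
  exact h

/-- A subfield of a finite extension (inside `ℂ`) is finite. [folklore] -/
private theorem finiteDimensional_of_le''' {E E' : IntermediateField ℚ ℂ} [FiniteDimensional ℚ E] (h : E' ≤ E) :
    FiniteDimensional ℚ E' :=
  FiniteDimensional.of_injective (IntermediateField.inclusion h).toLinearMap (IntermediateField.inclusion_injective h)

/-- **(□) and `4 ∤ [L_{i₀} : ℚ]`.**  Two slots `i₀ ≠ i₁`; if some `τ ∈ Aut(ℂ)` has `τ ∘ τ ∘ s = s̄` for every embedding
`s` of `K_{i₁}`, and the Galois closure `L_{i₀}` of `K_{i₀}` has degree NOT divisible by `4` (imaginary quadratic fields;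
Galois CM fields of degree `≡ 2 (mod 4)`), then complex conjugation fixes `L_{i₀} ∩ L_{i₁}` pointwise — no computation of
the intersection needed — and both slots carry partial conjugations. [cite: Gordon1999HodgeAVSurvey, §3 Theorem (proof)] -/
theorem forall_exists_partialConj_pair_of_smul_smul_of_not_dvd [Finite I] {i₀ i₁ : I} (h01 : i₀ ≠ i₁)
    (hI : ∀ j, j = i₀ ∨ j = i₁)
    (hτ : ∃ τ : ℂ ≃+* ℂ, ∀ s : K i₁ →+* ℂ, τ • τ • s = (starRingAut : ℂ ≃+* ℂ) • s)
    (h4 : ¬ 4 ∣ finrank ℚ (normalClosure ℚ (K i₀) ℂ)) :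
    ∀ i : I, ∃ σ : ℂ ≃+* ℂ, (∀ s : K i →+* ℂ, σ • s = (starRingAut : ℂ ≃+* ℂ) • s) ∧
      ∀ j, j ≠ i → ∀ s : K j →+* ℂ, σ • s = s := by
  obtain ⟨τ, hτ⟩ := hτ
  haveI : ∀ j : I, @Normal ℚ ↥(normalClosure ℚ (K j) ℂ) _ _ (IntermediateField.algebra' _) :=
    normal_normalClosure_complex
  letI iL₀ : Algebra ℚ ↥(normalClosure ℚ (K i₀) ℂ) := IntermediateField.algebra' _
  letI iL₁ : Algebra ℚ ↥(normalClosure ℚ (K i₁) ℂ) := IntermediateField.algebra' _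
  letI iM : Algebra ℚ ↥(normalClosure ℚ (K i₀) ℂ ⊓ normalClosure ℚ (K i₁) ℂ) := IntermediateField.algebra' _
  haveI : FiniteDimensional ℚ ↥(normalClosure ℚ (K i₀) ℂ ⊓ normalClosure ℚ (K i₁) ℂ) :=
    finiteDimensional_of_le''' inf_le_left
  have hM4 : ¬ 4 ∣ finrank ℚ ↥(normalClosure ℚ (K i₀) ℂ ⊓ normalClosure ℚ (K i₁) ℂ) := fun h =>
    h4 (h.trans (IntermediateField.finrank_dvd_of_le_right inf_le_left))
  exact forall_exists_partialConj_pair h01 hI fun x h₀ h₁ =>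
    conj_apply_eq_of_apply_apply_eq_conj_of_not_dvd _ τ
      (fun y hy => apply_apply_eq_conj_of_forall_smul_smul i₁ hτ (IntermediateField.mem_inf.1 hy).2) hM4 ⟨h₀, h₁⟩

/-- **(□) from a square `conjGal`, degree form**: `K_{i₁}` a Galois CM field in whose group complex conjugation is a
square, `4 ∤ [L_{i₀} : ℚ]` ⟹ both slots carry partial conjugations (combine with
`forall_exists_partialConj_pair_of_isSquare_conjGal` when instead `[L_{i₀} ∩ L_{i₁} : ℚ] ≤ 2` is known).  Here the
square root is realised in `Aut(ℂ)` by transitivity on embeddings. [cite: Lang2002, VI §1 Cor. 1.4] -/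
theorem forall_exists_partialConj_pair_of_isSquare_conjGal_of_not_dvd [Finite I] {i₀ i₁ : I} (h01 : i₀ ≠ i₁)
    (hI : ∀ j, j = i₀ ∨ j = i₁) [IsCMField (K i₁)] [IsGalois ℚ (K i₁)]
    (hsq : IsSquare (conjGal : K i₁ ≃ₐ[ℚ] K i₁)) (h4 : ¬ 4 ∣ finrank ℚ (normalClosure ℚ (K i₀) ℂ)) :
    ∀ i : I, ∃ σ : ℂ ≃+* ℂ, (∀ s : K i →+* ℂ, σ • s = (starRingAut : ℂ ≃+* ℂ) • s) ∧
      ∀ j, j ≠ i → ∀ s : K j →+* ℂ, σ • s = s := by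
  refine forall_exists_partialConj_pair_of_smul_smul_of_not_dvd h01 hI ?_ h4
  -- realise `g` with `g² = conjGal` as an automorphism of `ℂ` along one embedding
  obtain ⟨g, hg⟩ := hsq
  obtain ⟨s₀⟩ : Nonempty (K i₁ →+* ℂ) := inferInstance
  haveI : Countable (K i₁) := Countable.of_equiv _ (Module.finBasis ℚ (K i₁)).equivFun.toEquiv.symm
  obtain ⟨τ, hτ⟩ := Literature.AlgebraicGeometry.Motives.ZarhinLie.exists_ringEquiv_complex_comp_eq s₀
    (s₀.comp g.toRingEquiv.toRingHom)
  have hτ' : ∀ a : K i₁, τ (s₀ a) = s₀ (g a) := hτ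
  refine ⟨τ, fun s => ?_⟩
  -- every embedding is `s₀ ∘ w`, `w ∈ Gal(K/ℚ)` (`w ↦ s₀ ∘ w` is injective between sets of size `[K:ℚ]`)
  obtain ⟨w, rfl⟩ : ∃ w : K i₁ ≃ₐ[ℚ] K i₁, s = s₀.comp w.toRingEquiv.toRingHom := by
    classical
    have hinj : Function.Injective fun w : K i₁ ≃ₐ[ℚ] K i₁ => s₀.comp w.toRingEquiv.toRingHom := fun _ _ h =>
      AlgEquiv.ext fun x => s₀.injective (RingHom.congr_fun h x)
    have hbij : Function.Bijective fun w : K i₁ ≃ₐ[ℚ] K i₁ => s₀.comp w.toRingEquiv.toRingHom := by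
      rw [Fintype.bijective_iff_injective_and_card]
      refine ⟨hinj, ?_⟩
      rw [← Nat.card_eq_fintype_card, IsGalois.card_aut_eq_finrank, Embeddings.card]
    obtain ⟨w, hw⟩ := hbij.2 s
    exact ⟨w, hw.symm⟩
  refine RingHom.ext fun x => ?_
  change τ (τ (s₀ (w x))) = starRingAut (s₀ (w x))
  rw [hτ', hτ', ← AlgEquiv.mul_apply, ← hg, starRingAut_apply, ← starRingEnd_apply]
  exact algHom_conjGal_apply s₀.toRatAlgHom (w x)

end Pair

end Literature.NumberTheory.ComplexMultiplication

end
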